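import Mathlib
import Summits.Ventures.HodgeRepro.OcticCMPointTruncThree
import Summits.Ventures.HodgeRepro.OcticCMPointTameModel

/-!
# OcticCMPointTruncThreePsi5 — the conductor-`3` root number at `𝔭 | 5` for the standard `ψ₅`, exactly

Blind re-derivation cell `pub-hodge-repro`, seat night-2 (gen 4).  Target tree path
`lean/Summits/Ventures/HodgeRepro/OcticCMPointTruncThreePsi5.lean`.  Composes `OcticCMPointTruncThree.lean`
(`ε(½, ρ, ψ̃) = ρ(ϖ)^n · κ |k| · G(χ_quad, ψ₀(·/2))` for the explicit conductor-`3` twist on `𝒪/𝔭³` at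
`𝔭₁, 𝔭₂ | 5`) with `OcticCMPointTameModel.lean` (Gauss's sign at `𝔽₅`: `G(χ_quad, ψ₅(·/2)) = −√5` for the
standard `ψ₅ = ζ₅^x`), so that the sign left open in `OcticCMPointTruncThree.lean` is settled for `ψ₀ = ψ₅`:

* `eps_twist_three_psi5` — **`ε(½, ρ, ψ̃₅) = −ρ(ϖ)^n`** with `κ = (5√5)⁻¹ = |𝒪/𝔭³|^{−1/2}`;
* `eps_tame_twist_three_psi5` — **`ε(½, χρ, ψ̃₅) = −(χ(ϖ)ρ(ϖ))^n`** for every tame line `χ`;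
* `E3_tame_twist_three_psi5` — (E3) at `𝔭 | 5` for four tame lines twisted by the conductor-`3` twist, from the
  `ϖ`-part of N2 (the common sign `(−1)²` cancels).

At conductor `3` the root number of the explicit twist is therefore `−ρ(ϖ)^n` for `ψ₅` (and `+ρ(ϖ)^n` at
conductor `4`, `OcticCMPointTruncFour.lean`): the `ψ_δ`-dependence of the sign at an odd conductor is the
quadratic Gauss sum's, as ROUTE-B §9.9 (f) expects.

**What this is not.**  The four `χ′_j` of the octic face are on no page; `c ≥ 5` is not covered.  Nothing here
says anything about the status of the Hodge conjecture for CM abelian varieties, which is NOT proved.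
-/

set_option autoImplicit false

noncomputable section

namespace Summit.Ventures.HodgeRepro.PeriodCloser

open GaussSumStability

namespace TruncModel

/-- `√5 ≠ 0` in `ℂ`. -/
theorem sqrt_five_ne_zero : ((Real.sqrt 5 : ℝ) : ℂ) ≠ 0 := by
  rw [Complex.ofReal_ne_zero]
  exact (Real.sqrt_pos.2 (by norm_num)).ne'

/-- **The conductor-`3` quadratic Gauss sum for `ψ₅`** in the vocabulary of `OcticCMPointTruncThree.lean`:
`G(χ_quad, ψ₅(·/2)) = −√5` (`OcticCMPointTameModel.gaussSum_quad_psi5_half`; `quadChar (ZMod 5) = quadChar5`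
definitionally). -/
theorem gaussSum_quadChar_psi5_half :
    gaussSum (quadChar (ZMod 5)) (AddChar.mulShift TameModel.psi5 (2 : ZMod 5)⁻¹) =
      -((Real.sqrt 5 : ℝ) : ℂ) :=
  TameModel.gaussSum_quad_psi5_half

/-- **`ε(½, ρ, ψ̃₅) = −ρ(ϖ)^n` at conductor `3`**, `κ = (5√5)⁻¹`: Gauss's sign makes the root number of the
explicit conductor-`3` twist exactly `−ρ(ϖ)^n` for the standard additive character `ψ₅`. -/
theorem eps_twist_three_psi5 (n : ℕ) (π : ℂ) :
    LocalChar.eps (((5 * Real.sqrt 5)⁻¹ : ℝ) : ℂ) n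
      (⟨twist 3 (by norm_num) (by norm_num) (by decide) (by decide) 1 TameModel.psi5, π⟩ :
        LocalChar (Trunc (ZMod 5) 3)) (psiTilde 3 TameModel.psi5) = -π ^ n := by
  rw [eps_twist_three (by decide) (by decide) TameModel.psi5 TameModel.psi5_isPrimitive, ZMod.card,
    gaussSum_quadChar_psi5_half]
  have h5 := sqrt_five_ne_zero
  push_cast
  field_simp

/-- **The twisted tame lines at conductor `3` for `ψ₅`**: `ε(½, χρ, ψ̃₅) = −(χ(ϖ)ρ(ϖ))^n`. -/
theorem eps_tame_twist_three_psi5 (n : ℕ) (θ : MulChar (ZMod 5) ℂ) (πχ π : ℂ) :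
    LocalChar.eps (((5 * Real.sqrt 5)⁻¹ : ℝ) : ℂ) n
      ((⟨tame 3 (by norm_num) θ, πχ⟩ : LocalChar (Trunc (ZMod 5) 3)) *
        ⟨twist 3 (by norm_num) (by norm_num) (by decide) (by decide) 1 TameModel.psi5, π⟩)
      (psiTilde 3 TameModel.psi5) = -(πχ * π) ^ n := by
  rw [eps_tame_twist_three (by decide) (by decide) TameModel.psi5 TameModel.psi5_isPrimitive, ZMod.card,
    gaussSum_quadChar_psi5_half]
  have h5 := sqrt_five_ne_zero
  push_cast
  field_simp

/-- **(E3) at `𝔭 | 5` for four tame lines twisted by the conductor-`3` twist, for `ψ₅`**: with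
`ε_j = −(χ_j(ϖ) ρ(ϖ))^n`, `ε₀ ε₁ = ε₂ ε₃` follows from the `ϖ`-part of N2 (`χ₀(ϖ)χ₁(ϖ) = χ₂(ϖ)χ₃(ϖ)`). -/
theorem E3_tame_twist_three_psi5 (n : ℕ) (θ : Fin 4 → MulChar (ZMod 5) ℂ) (π' : Fin 4 → ℂ) (π : ℂ)
    (hN2 : π' 0 * π' 1 = π' 2 * π' 3) :
    LocalChar.eps (((5 * Real.sqrt 5)⁻¹ : ℝ) : ℂ) n
        ((⟨tame 3 (by norm_num) (θ 0), π' 0⟩ : LocalChar (Trunc (ZMod 5) 3)) *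
          ⟨twist 3 (by norm_num) (by norm_num) (by decide) (by decide) 1 TameModel.psi5, π⟩)
        (psiTilde 3 TameModel.psi5) *
      LocalChar.eps (((5 * Real.sqrt 5)⁻¹ : ℝ) : ℂ) n
        ((⟨tame 3 (by norm_num) (θ 1), π' 1⟩ : LocalChar (Trunc (ZMod 5) 3)) *
          ⟨twist 3 (by norm_num) (by norm_num) (by decide) (by decide) 1 TameModel.psi5, π⟩)
        (psiTilde 3 TameModel.psi5) =
    LocalChar.eps (((5 * Real.sqrt 5)⁻¹ : ℝ) : ℂ) n
        ((⟨tame 3 (by norm_num) (θ 2), π' 2⟩ : LocalChar (Trunc (ZMod 5) 3)) *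
          ⟨twist 3 (by norm_num) (by norm_num) (by decide) (by decide) 1 TameModel.psi5, π⟩)
        (psiTilde 3 TameModel.psi5) *
      LocalChar.eps (((5 * Real.sqrt 5)⁻¹ : ℝ) : ℂ) n
        ((⟨tame 3 (by norm_num) (θ 3), π' 3⟩ : LocalChar (Trunc (ZMod 5) 3)) *
          ⟨twist 3 (by norm_num) (by norm_num) (by decide) (by decide) 1 TameModel.psi5, π⟩)
        (psiTilde 3 TameModel.psi5) := by
  rw [eps_tame_twist_three_psi5, eps_tame_twist_three_psi5, eps_tame_twist_three_psi5,
    eps_tame_twist_three_psi5]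
  calc -(π' 0 * π) ^ n * -(π' 1 * π) ^ n = ((π' 0 * π' 1) * π ^ 2) ^ n := by ring
    _ = ((π' 2 * π' 3) * π ^ 2) ^ n := by rw [hN2]
    _ = -(π' 2 * π) ^ n * -(π' 3 * π) ^ n := by ring

end TruncModel

end Summit.Ventures.HodgeRepro.PeriodCloser

end
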